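import Mathlib.Analysis.SpecialFunctions.Pow.Asymptotics
import Mathlib.Analysis.SpecialFunctions.Pow.Deriv
import Literature.Analysis.FluidPDE.FlatSwirlGauge
import Literature.Analysis.FluidPDE.HarmonicProbe
import Literature.Analysis.FluidPDE.LeraySelfSimilarCalculus
import Literature.Analysis.FluidPDE.HouTwoScaleRescaling
import Literature.Analysis.FluidPDE.SelfSimilarBoussinesqProfile
import Literature.Analysis.FluidPDE.SelfSimilarEulerProfile
import Literature.Analysis.FluidPDE.SuitableWeak
import Literature.Analysis.FluidPDE.WeakSolution
import HarnessLib

/-!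
# The power-law ("generalized") self-similar collapse ansatz with a free exponent `γ`
# and its exact scaling bookkeeping (velocity, vorticity, circulation, effective viscosity)

Topic `Literature/Analysis/FluidPDE`. Definitions with bodies and PROVED scaling identities; the
only data recorded from a source are two printed numerical constants of Chen–Hou (see
`chenHou_cl`, `chenHou_cω`), kept as real numbers with their locator. No named facts.

## The ansatz as printed

Fix a blow-up time `T` and an exponent `γ : ℝ` (the **collapse exponent**). The ansatz

  `u(x, t) = (T − t)^{γ − 1} U(x / (T − t)^γ)`,  `p(x, t) = (T − t)^{2(γ−1)} P(x / (T − t)^γ)`,   (SS_γ)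

with length scale `ℓ(t) = (T − t)^γ`, velocity scale `(T − t)^{γ−1} = ℓ/(T − t)` and vorticity scale
`(T − t)^{−1}`, is, with the singular point translated to the origin,

* Constantin–Ignatova–Vicol, arXiv:2602.17570 §3, (3.2): "`u(x,t) = (1−t)^{γ−1} U(y)`,
  `p(x,t) = (1−t)^{2(γ−1)} P(y)`, `ω(x,t) = (1−t)^{−1} Ω(y)`, `y = x/(1−t)^γ`" (`T = 1`); their
  stationary profile equation (3.3) is the tree's `IsSelfSimilarEulerProfile γ c U P`
  (`SelfSimilarEulerProfile.lean`);
* Chae 2007 (Math. Ann. 338 = arXiv:math/0604234), Cor. 1.1: the "`α`-self-similar" representation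
  of the vorticity `ω(x,t) = (T−t)^{−1} Ω̄(x/(T−t)^{1/(α+1)})`, i.e. `γ = 1/(α+1)`;
* Elgindi 2021 (Ann. Math. 194), Remark 1.3 (arXiv:1904.04795 p. 4): "`ω(x,t) = (1−t)^{−1} F(x/(1−t)^ξ)`
  for some constant `ξ > 0`" (`γ = ξ`);
* Hou 2026 (FoCM; arXiv:2405.10916), §1.1: "If we denote `λ(t)√(T−t) ≡ (T−t)^{c_l}`, then we have
  `c_l = 0.5233`" (`γ = c_l`), and §3: the constant-exponent dictionary of the dynamic rescaling
  formulation (`C_l(τ) = (T−t)^{ĉ_l}`);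
* the cell census `SELFSIM-NOGO.md` (M1) of the `ns-blowup` programme uses exactly (SS_γ) with
  `γ = c_l`; Leray 1934's backward self-similar ansatz is `γ = ½` (`lerayBackward`, `SelfSimilar.lean`;
  bridge `lerayBackward_eq_selfSimilarCollapse` below).

## What is proved (every item is a `theorem`; `y := (T − t)^{−γ} x`, `t < T`)

* `norm_selfSimilarCollapse` — `‖u(t,x)‖ = (T−t)^{γ−1}‖U(y)‖`; for a bounded profile `‖U‖ ≤ M`:
  `√(T−t) ‖u(t,x)‖ ≤ M (T−t)^{γ−½}` (`sqrt_mul_norm_selfSimilarCollapse_le`), hence for `γ > ½` the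
  Type-I constant tends to zero, `∀ ε > 0, ∀ᶠ t ↑ T, ∀ x, √(T−t)‖u(t,x)‖ ≤ ε`
  (`eventually_sqrt_mul_norm_le_of_half_lt`) and NO Leray-type lower bound `c/√(T−t) ≤ ‖u(t,x_t)‖`
  can hold (`not_frequently_leray_lower_bound_of_half_lt`) — the hypothesis of SELFSIM-NOGO (M5)(a),
  to be confronted with the tree's `leray_blowup_rate_top`; and for `γ ≥ ½` the field obeys the
  Type-I bound of `IsTypeIBlowup` (`isTypeIBlowup_selfSimilarCollapse`) — the hypothesis under which
  the tree's `knss_no_axisymmetric_typeI_holds` / `Literature.Barriers…AxisymmetricTypeIExclusion`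
  exclude axisymmetric blow-up.
* `fderiv_selfSimilarCollapse`, `curl_selfSimilarCollapse` (`ℝ³`): `Du(t) = (T−t)^{−1} DU(y)`,
  `ω(t,x) = (T−t)^{−1} (curl U)(y)` — the vorticity rate is `(T−t)^{−1}` for EVERY `γ`.
* `swirl_selfSimilarCollapse` (`ℝ³`): the circulation `Γ = r u_θ = swirl (u t)` scales as
  `Γ(t,x) = (T−t)^{2γ−1} Γ_U(y)`; hence if `γ < ½` and the profile carries swirl (`Γ_U(y₀) ≠ 0` for
  some `y₀`) then `sup_x |Γ(t,x)| → ∞` as `t ↑ T` (`swirl_unbounded_of_lt_half`) — the hypothesis of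
  SELFSIM-NOGO (M5)(b), incompatible with the circulation maximum principle
  (`abs_swirl_le_of_classical`, `SwirlMaximumPrinciple.lean`); Hou 2026 §3 (p. 11 of the held text):
  "Due to the total circulation conservation … we expect to have `c_l → 1/2`".
* `convect_selfSimilarCollapse`, `laplacian_selfSimilarCollapse`, `hasDerivAt_selfSimilarCollapse_time`,
  `gradient_selfSimilarCollapsePressure`: every term of the Navier–Stokes momentum operator applied
  to (SS_γ) is `(T−t)^{γ−2}` times a profile term at `y`, EXCEPT the viscous one, which carries the
  extra factor `(T−t)^{1−2γ}`:
  `∂ₜu + (u·∇)u + ∇p − νΔu = (T−t)^{γ−2} • [(1−γ)U + DU(γy + U) + ∇P − ν(T−t)^{1−2γ} ΔU](y)`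
  (`ns_momentum_selfSimilarCollapse`). So an exact Euler profile (`IsSelfSimilarEulerProfile γ 0 U P`)
  gives an exact Euler solution for `t < T` (`IsSelfSimilarEulerProfile.euler_selfSimilarCollapse`)
  whose Navier–Stokes defect is exactly `−ν(T−t)^{−1−γ} ΔU(y)`
  (`IsSelfSimilarEulerProfile.ns_defect_selfSimilarCollapse`), and in similarity variables the
  viscosity is the **effective viscosity** `ν_eff(t) = ν (T−t)^{1−2γ}` (`effectiveViscosity`):
  `→ 0` for `γ < ½` (viscosity asymptotically perturbative: the "Euler window" edge of the cell's
  LIT-DOSSIER §8 / route `VortexLineClock.TypeIIWindowCore`), `= ν` at Leray's `γ = ½`, and `→ +∞`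
  for `γ > ½` (`tendsto_effectiveViscosity_atTop_of_half_lt`: diffusion is NOT a perturbation of
  such a profile — the cell's SELFSIM-NOGO (M8) remark).
* The dynamic-rescaling dictionary for CONSTANT exponents (Hou 2026 §3, p. 10–11: "`τ = log(1/(T−t))/
  (c_lz − c_ψ)`, `C_lz(τ) = (T−t)^{ĉ_lz}`"; Chen–Hou 2021 §4.1 = tree `DynamicRescalingBlowup.lean`):
  if `T − t = e^{c_ω τ}/|c_ω|` (`c_ω < 0`) then the spatial factor `C_l = e^{−c_l τ}` equals
  `(|c_ω|(T−t))^{c_l/|c_ω|}` (`rescalingFactor_eq_rpow_of_constant_exponents`), i.e. the collapse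
  exponent of a steady dynamic-rescaling profile is `γ = c_l/|c_ω|`. With Chen–Hou's printed
  approximate-profile exponents `c̄_l ≈ 3.00649898`, `c̄_ω ≈ −1.02942516` (Part I §3, "ratio
  `c̄_l/c̄_ω ≈ −2.9205600`") this gives `γ_CH = c̄_l/|c̄_ω| > ½` (indeed `> 2.9`,
  `chenHou_collapseExponent_gt`), so `ν_eff → +∞` along that profile
  (`tendsto_effectiveViscosity_chenHou_atTop`): the arithmetic behind SELFSIM-NOGO (M8) "the
  Chen–Hou route does not transplant to NS by adding viscosity".  The same one-liners for the other
  printed exponents of the profile literature: Hou 2026's `c_l = 0.5233 > ½`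
  (`tendsto_effectiveViscosity_hou2026_atTop`, exponent from `HouTwoScaleRescaling.lean`) and the
  Wang et al. 2025 Boussinesq/Euler law `γ_n = 1 + λ_n > 2` (`effectiveViscosity_wlgsb`,
  `tendsto_effectiveViscosity_wlgsb_atTop`, from `SelfSimilarBoussinesqProfile.lean`).

## WHAT THIS IS NOT

Not a statement about Navier–Stokes blow-up and not the census (M5) itself (which needs CKN /
ε-regularity and lives with the cell): only the exact algebra of the ansatz, so that every
"violated hypothesis" of the census is a Lean term. The Chen–Hou numbers are printed parameters of a
numerically computed approximate profile (data, tagged with their locator), not theorems; nothing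
here asserts anything about the true Boussinesq/Euler solutions beyond what `ChenHouBlowup.lean`
vendors.

## Design notes

* Singular point at the origin and no rotation: `u t x = (T−t)^{γ−1} • U((T−t)^{−γ} • x)` on a real
  normed space `E` (translation/rotation are symmetries of the equations; SELFSIM-NOGO (M0): "WLOG
  `x₀ = 0`"; CIV (3.2)). Powers are `Real.rpow`; every statement assumes `t < T` (for `t ≥ T` the
  values are junk, as for `lerayBackward`).
* `swirl u x = x₀u₁ − x₁u₀` (`AxisymmetricEuler.lean`) is junk-free, so the circulation scaling needs
  no axisymmetry hypothesis.
* The momentum identity uses the two-sided `timeDeriv` (`WeakSolution.lean`) at interior times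
  `t < T` and the tree's dilation calculus (`fderiv_const_smul_comp_smul'`, `curl_smul_comp_smul`,
  `gradient_comp_smul`, `laplacian_const_smul_comp_smul`).

## Mathlib / tree search

`lean search 'selfSimilarCollapse|collapseExponent|effectiveViscosity|generali[sz]ed self-similar'`:
only `CIV2026_collapseExponent_ge_two_fifths` (`PutativeSelfSimilarEuler.lean`, the finite-energy
bound `γ ≥ 2/5`) and Summits-side prose; the physical-space ansatz with free `γ` was not defined
(`lerayBackward` fixes `γ = ½`, `IsSelfSimilarEulerProfile` is the profile-side PDE). Mathlib:
`Real.rpow` calculus (`Real.rpow_add`, `HasDerivAt.rpow_const`, `tendsto_rpow_neg_nhdsGT_zero`,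
`Real.continuousAt_rpow_const`).

## References

* P. Constantin, M. Ignatova, V. Vicol, arXiv:2602.17570 (2026), §3 (3.2)–(3.3).
  [ConstantinIgnatovaVicol2026Putative]
* D. Chae, Math. Ann. 338 (2007) 435–449 = arXiv:math/0604234, Cor. 1.1. [Chae2007]
* T. M. Elgindi, Ann. of Math. 194 (2021), Remark 1.3. [Elgindi2021AnnMath]
* T. Y. Hou, Found. Comput. Math. (2026) = arXiv:2405.10916, §1.1, §3. [Hou2026]
* J. Chen, T. Y. Hou, arXiv:2210.07191 (Part I), §3 "Exponents" (p. 12 of the held text):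
  `c̄_l ≈ 3.00649898`, `c̄_ω ≈ −1.02942516`, ratio `≈ −2.9205600`. [arXiv221007191]
* J. Leray, Acta Math. 63 (1934), (3.11)–(3.12) (`γ = ½`). [Leray1934]
-/

noncomputable section

open Set Filter Topology InnerProductSpace
open scoped Laplacian RealInnerProductSpace

namespace Literature.Analysis.FluidPDE

/-! ### The ansatz -/

section Ansatz

variable {E : Type*} [NormedAddCommGroup E] [NormedSpace ℝ E]
variable {F : Type*} [NormedAddCommGroup F] [NormedSpace ℝ F]

/-- The **power-law self-similar collapse ansatz** with collapse exponent `γ` and blow-up time `T`,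
singular point at the origin: `u(t, x) = (T − t)^{γ−1} • U((T − t)^{−γ} • x)` (length scale
`(T−t)^γ`, velocity scale `(T−t)^{γ−1}`). Constantin–Ignatova–Vicol (3.2) (`T = 1`); Chae 2007
Cor. 1.1 with `γ = 1/(α+1)`; Hou 2026 §1.1 with `γ = c_l`; Leray 1934 is `γ = ½`
(`lerayBackward_eq_selfSimilarCollapse`). Meaningful for `t < T`; junk for `t ≥ T`. [cite: ConstantinIgnatovaVicol2026Putative, §3.1 eq. (3.2)] -/
def selfSimilarCollapse (γ T : ℝ) (U : E → F) : ℝ → E → F :=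
  fun t x => (T - t) ^ (γ - 1) • U ((T - t) ^ (-γ) • x)

/-- The pressure of the ansatz: `p(t, x) = (T − t)^{2(γ−1)} P((T − t)^{−γ} • x)`
(Constantin–Ignatova–Vicol (3.2)). [cite: ConstantinIgnatovaVicol2026Putative, §3.1 eq. (3.2)] -/
def selfSimilarCollapsePressure (γ T : ℝ) (P : E → ℝ) : ℝ → E → ℝ :=
  fun t x => (T - t) ^ (2 * (γ - 1)) * P ((T - t) ^ (-γ) • x)

/-- Unfolding the ansatz. [cite: ConstantinIgnatovaVicol2026Putative, §3.1 eq. (3.2)] -/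
@[simp]
theorem selfSimilarCollapse_apply (γ T : ℝ) (U : E → F) (t : ℝ) (x : E) :
    selfSimilarCollapse γ T U t x = (T - t) ^ (γ - 1) • U ((T - t) ^ (-γ) • x) := rfl

/-- Unfolding the pressure ansatz. [cite: ConstantinIgnatovaVicol2026Putative, §3.1 eq. (3.2)] -/
@[simp]
theorem selfSimilarCollapsePressure_apply (γ T : ℝ) (P : E → ℝ) (t : ℝ) (x : E) :
    selfSimilarCollapsePressure γ T P t x = (T - t) ^ (2 * (γ - 1)) * P ((T - t) ^ (-γ) • x) :=
  rfl

/-- The ansatz of the zero profile is zero. [cite: ConstantinIgnatovaVicol2026Putative, §3.1 eq. (3.2) (scaling consequence of the ansatz)] -/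
@[simp]
theorem selfSimilarCollapse_zero (γ T : ℝ) : selfSimilarCollapse γ T (0 : E → F) = 0 := by
  funext t x
  simp

variable {γ T t : ℝ}

/-- Exponent bookkeeping: `(T−t)^{a} (T−t)^{b} = (T−t)^{a+b}` below the blow-up time. [folklore] -/
private theorem rpow_sub_time_mul (ht : t < T) (a b : ℝ) :
    (T - t) ^ a * (T - t) ^ b = (T - t) ^ (a + b) :=
  (Real.rpow_add (sub_pos.mpr ht) a b).symm

/-- `(T − t)^a > 0` below the blow-up time. [folklore] -/
private theorem rpow_sub_time_pos (ht : t < T) (a : ℝ) : 0 < (T - t) ^ a :=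
  Real.rpow_pos_of_pos (sub_pos.mpr ht) a

/-- `T − t → 0⁺` as `t ↑ T`. [folklore] -/
private theorem tendsto_sub_nhdsLT_nhdsGT (T : ℝ) :
    Tendsto (fun t : ℝ => T - t) (𝓝[<] T) (𝓝[>] 0) := by
  refine tendsto_nhdsWithin_of_tendsto_nhds_of_eventually_within _ ?_ ?_
  · have : Tendsto (fun t : ℝ => T - t) (𝓝 T) (𝓝 (T - T)) :=
      (continuous_const.sub continuous_id).tendsto T
    rw [sub_self] at this
    exact this.mono_left nhdsWithin_le_nhds
  · filter_upwards [self_mem_nhdsWithin] with t ht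
    exact sub_pos.mpr (Set.mem_Iio.mp ht)

/-- **Velocity scale.** `‖u(t, x)‖ = (T − t)^{γ−1} ‖U(y)‖`, `y = (T−t)^{−γ} x`, for `t < T`. [cite: ConstantinIgnatovaVicol2026Putative, §3.1 eq. (3.2)] -/
theorem norm_selfSimilarCollapse (ht : t < T) (U : E → F) (x : E) :
    ‖selfSimilarCollapse γ T U t x‖ = (T - t) ^ (γ - 1) * ‖U ((T - t) ^ (-γ) • x)‖ := by
  rw [selfSimilarCollapse_apply, norm_smul, Real.norm_of_nonneg (rpow_sub_time_pos ht _).le]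

/-- Sup bound: a bounded profile `‖U‖ ≤ M` gives `‖u(t, x)‖ ≤ M (T−t)^{γ−1}` (SELFSIM-NOGO (M5)(a),
first line). [cite: ConstantinIgnatovaVicol2026Putative, §3.1 eq. (3.2) (scaling consequence of the ansatz)] -/
theorem norm_selfSimilarCollapse_le (ht : t < T) {U : E → F} {M : ℝ} (hM : ∀ y, ‖U y‖ ≤ M)
    (x : E) : ‖selfSimilarCollapse γ T U t x‖ ≤ M * (T - t) ^ (γ - 1) := by
  rw [norm_selfSimilarCollapse ht, mul_comm]
  exact mul_le_mul_of_nonneg_right (hM _) (rpow_sub_time_pos ht _).le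

/-- The Type-I quantity: `√(T−t) ‖u(t, x)‖ ≤ M (T−t)^{γ−½}` for a bounded profile. [cite: ConstantinIgnatovaVicol2026Putative, §3.1 eq. (3.2) (scaling consequence of the ansatz)] -/
theorem sqrt_mul_norm_selfSimilarCollapse_le (ht : t < T) {U : E → F} {M : ℝ} (hM : ∀ y, ‖U y‖ ≤ M)
    (x : E) : Real.sqrt (T - t) * ‖selfSimilarCollapse γ T U t x‖ ≤ M * (T - t) ^ (γ - 1 / 2) := by
  have h0 : 0 ≤ Real.sqrt (T - t) := Real.sqrt_nonneg _
  calc Real.sqrt (T - t) * ‖selfSimilarCollapse γ T U t x‖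
      ≤ Real.sqrt (T - t) * (M * (T - t) ^ (γ - 1)) :=
        mul_le_mul_of_nonneg_left (norm_selfSimilarCollapse_le ht hM x) h0
    _ = M * (T - t) ^ (γ - 1 / 2) := by
        rw [Real.sqrt_eq_rpow, mul_left_comm, rpow_sub_time_mul ht,
          show 1 / (2 : ℝ) + (γ - 1) = γ - 1 / 2 by ring]

/-- For `γ > ½`, `(T − t)^{γ − ½} → 0` as `t ↑ T`. [folklore] -/
private theorem tendsto_rpow_sub_half_nhdsLT (hγ : 1 / 2 < γ) :
    Tendsto (fun t => (T - t) ^ (γ - 1 / 2)) (𝓝[<] T) (𝓝 0) := by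
  have h1 : Tendsto (fun t : ℝ => T - t) (𝓝[<] T) (𝓝 0) :=
    (tendsto_sub_nhdsLT_nhdsGT T).mono_right nhdsWithin_le_nhds
  have h2 : ContinuousAt (fun s : ℝ => s ^ (γ - 1 / 2)) 0 :=
    Real.continuousAt_rpow_const 0 _ (Or.inr (by linarith))
  have h3 := h2.tendsto.comp h1
  rwa [Function.comp_def, Real.zero_rpow (by linarith : (0 : ℝ) < γ - 1 / 2).ne'] at h3

/-- **`γ > ½` violates Leray's rate** (SELFSIM-NOGO (M5)(a)): for a bounded profile and `γ > ½`
the Type-I constant of the ansatz tends to zero, `∀ ε > 0, ∀ᶠ t ↑ T, ∀ x, √(T−t) ‖u(t,x)‖ ≤ ε`.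
Leray 1934 (3.9) / the tree's `leray_blowup_rate_top` give the opposite inequality
`c√ν/√(T−t) ≤ ‖u(t)‖_∞` before a genuine blow-up time. [cite: ConstantinIgnatovaVicol2026Putative, §3.1 eq. (3.2) (scaling consequence of the ansatz)] -/
theorem eventually_sqrt_mul_norm_le_of_half_lt (hγ : 1 / 2 < γ) {U : E → F} {M : ℝ}
    (hM : ∀ y, ‖U y‖ ≤ M) {ε : ℝ} (hε : 0 < ε) :
    ∀ᶠ t in 𝓝[<] T, ∀ x, Real.sqrt (T - t) * ‖selfSimilarCollapse γ T U t x‖ ≤ ε := by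
  have h := (tendsto_rpow_sub_half_nhdsLT (T := T) hγ).const_mul M
  rw [mul_zero] at h
  filter_upwards [h.eventually_lt_const hε, self_mem_nhdsWithin] with t ht htT x
  exact (sqrt_mul_norm_selfSimilarCollapse_le (Set.mem_Iio.mp htT) hM x).trans ht.le

/-- **No Leray-type lower bound for `γ > ½`**: with a bounded profile it is impossible that
`c/√(T−t) ≤ ‖u(t, x_t)‖` at points `x_t` for `t` arbitrarily close to `T`, for any `c > 0`
(negation of the shape of Leray's (3.9); SELFSIM-NOGO (M5)(a)). [cite: ConstantinIgnatovaVicol2026Putative, §3.1 eq. (3.2) (scaling consequence of the ansatz)] -/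
theorem not_frequently_leray_lower_bound_of_half_lt (hγ : 1 / 2 < γ) {U : E → F} {M : ℝ}
    (hM : ∀ y, ‖U y‖ ≤ M) {c : ℝ} (hc : 0 < c) :
    ¬ ∃ᶠ t in 𝓝[<] T, ∃ x, c / Real.sqrt (T - t) ≤ ‖selfSimilarCollapse γ T U t x‖ := by
  rw [not_frequently]
  filter_upwards [eventually_sqrt_mul_norm_le_of_half_lt (T := T) hγ hM (half_pos hc),
    self_mem_nhdsWithin] with t ht htT
  simp only [not_exists, not_le]
  intro x
  have hs : 0 < Real.sqrt (T - t) := Real.sqrt_pos.mpr (sub_pos.mpr (Set.mem_Iio.mp htT))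
  have h1 : Real.sqrt (T - t) * ‖selfSimilarCollapse γ T U t x‖ < c := by linarith [ht x]
  rw [lt_div_iff₀ hs, mul_comm]
  exact h1

/-- **`γ ≥ ½` is Type-I rate** (the hypothesis under which Koch–Nadirashvili–Seregin–Šverák /
Seregin–Šverák exclude axisymmetric blow-up, tree `knss_no_axisymmetric_typeI_holds` and barrier
`AxisymmetricTypeIExclusion`): for a bounded profile and `γ ≥ ½` the ansatz satisfies
`‖u(t, x)‖ ≤ C/√(T−t)` for all `x` and all `t ∈ (T−1, T)` (SELFSIM-NOGO (M13)). [cite: ConstantinIgnatovaVicol2026Putative, §3.1 eq. (3.2) (scaling consequence of the ansatz)] -/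
theorem isTypeIBlowup_selfSimilarCollapse (hγ : 1 / 2 ≤ γ) {U : E → E} {M : ℝ} (hM : ∀ y, ‖U y‖ ≤ M) :
    IsTypeIBlowup (selfSimilarCollapse γ T U) T := by
  have hM0 : 0 ≤ M := (norm_nonneg (U 0)).trans (hM 0)
  refine ⟨M, ?_⟩
  have hI : Ioo (T - 1) T ∈ 𝓝[<] T := Ioo_mem_nhdsLT (by linarith)
  filter_upwards [hI] with t ht x
  have htT : t < T := ht.2
  have hpos : 0 < T - t := sub_pos.mpr htT
  have hle1 : T - t ≤ 1 := by linarith [ht.1]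
  have hs : 0 < Real.sqrt (T - t) := Real.sqrt_pos.mpr hpos
  rw [le_div_iff₀ hs, mul_comm]
  calc Real.sqrt (T - t) * ‖selfSimilarCollapse γ T U t x‖ ≤ M * (T - t) ^ (γ - 1 / 2) :=
        sqrt_mul_norm_selfSimilarCollapse_le htT hM x
    _ ≤ M * 1 := by
        refine mul_le_mul_of_nonneg_left ?_ hM0
        exact Real.rpow_le_one hpos.le hle1 (by linarith)
    _ = M := mul_one M

end Ansatz

/-! ### Leray's ansatz is the case `γ = ½` -/

section Leray

variable {E : Type*} [NormedAddCommGroup E] [InnerProductSpace ℝ E]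

/-- **Leray 1934 is `γ = ½`.** For `a > 0` and `t < T`, Leray's backward field
`(2a(T−t))^{-1/2} U(x/√(2a(T−t)))` (`lerayBackward a T U`) is the collapse ansatz with exponent
`½` of the rescaled profile `V = (2a)^{-1/2} U((2a)^{-1/2} ·)` (`nsRescaleData`). [cite: Leray1934, (3.11)–(3.12)] -/
theorem lerayBackward_eq_selfSimilarCollapse {a T t : ℝ} (ha : 0 < a) (ht : t < T) (U : E → E) :
    lerayBackward a T U t =
      selfSimilarCollapse (1 / 2) T (nsRescaleData (Real.sqrt (2 * a))⁻¹ U) t := by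
  have hpos : 0 < T - t := sub_pos.mpr ht
  have h2a : 0 < 2 * a := by positivity
  have hsplit : (Real.sqrt (2 * a * (T - t)))⁻¹ = (T - t) ^ (-(1 / 2 : ℝ)) * (Real.sqrt (2 * a))⁻¹ := by
    rw [Real.sqrt_mul h2a.le, mul_inv, mul_comm, Real.sqrt_eq_rpow (T - t),
      ← Real.rpow_neg hpos.le]
  funext x
  rw [lerayBackward_apply, selfSimilarCollapse_apply, nsRescaleData_apply, smul_smul, smul_smul,
    hsplit, show (1 : ℝ) / 2 - 1 = -(1 / 2) by norm_num,
    mul_comm ((Real.sqrt (2 * a))⁻¹) ((T - t) ^ (-(1 / 2 : ℝ)))]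

end Leray

/-! ### Space derivatives: velocity gradient, vorticity, convection, Laplacian, pressure gradient -/

section Derivatives

variable {E : Type*} [NormedAddCommGroup E] [InnerProductSpace ℝ E] [FiniteDimensional ℝ E]
variable {γ T t : ℝ}

omit [FiniteDimensional ℝ E] in
/-- **Velocity gradient**: `D(u(t))(x) = (T−t)^{−1} • DU(y)` (`(T−t)^{γ−1}(T−t)^{−γ} = (T−t)^{−1}`). [cite: ConstantinIgnatovaVicol2026Putative, §3.1 eq. (3.2) (scaling consequence of the ansatz)] -/
theorem fderiv_selfSimilarCollapse (ht : t < T) (U : E → E) (x : E) :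
    fderiv ℝ (selfSimilarCollapse γ T U t) x =
      (T - t) ^ (-1 : ℝ) • fderiv ℝ U ((T - t) ^ (-γ) • x) := by
  rw [show selfSimilarCollapse γ T U t = fun y => (T - t) ^ (γ - 1) • U ((T - t) ^ (-γ) • y)
    from rfl, fderiv_const_smul_comp_smul', rpow_sub_time_mul ht,
    show γ - 1 + -γ = (-1 : ℝ) by ring]

omit [FiniteDimensional ℝ E] in
/-- **Convection term**: `((u·∇)u)(t, x) = (T−t)^{γ−2} • ((U·∇)U)(y)`. [cite: ConstantinIgnatovaVicol2026Putative, §3.1 eq. (3.2) (scaling consequence of the ansatz)] -/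
theorem convect_selfSimilarCollapse (ht : t < T) (U : E → E) (x : E) :
    convect (selfSimilarCollapse γ T U t) (selfSimilarCollapse γ T U t) x =
      (T - t) ^ (γ - 2) • convect U U ((T - t) ^ (-γ) • x) := by
  simp only [convect, fderiv_selfSimilarCollapse ht, selfSimilarCollapse_apply, smul_apply, map_smul,
    smul_smul]
  rw [rpow_sub_time_mul ht, show γ - 1 + -1 = γ - 2 by ring]

/-- **Laplacian**: `Δ(u(t))(x) = (T−t)^{−1−γ} • (ΔU)(y)` (no regularity hypothesis: the tree's
`laplacian_const_smul_comp_smul`). [cite: ConstantinIgnatovaVicol2026Putative, §3.1 eq. (3.2) (scaling consequence of the ansatz)] -/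
theorem laplacian_selfSimilarCollapse (ht : t < T) (U : E → E) (x : E) :
    (Δ (selfSimilarCollapse γ T U t)) x = (T - t) ^ (-1 - γ) • (Δ U) ((T - t) ^ (-γ) • x) := by
  have hc : (T - t) ^ (-γ) ≠ 0 := (rpow_sub_time_pos ht _).ne'
  have h := laplacian_const_smul_comp_smul U ((T - t) ^ (γ - 1)) hc x
  rw [show selfSimilarCollapse γ T U t = fun y => (T - t) ^ (γ - 1) • U ((T - t) ^ (-γ) • y)
    from rfl, h, sq, ← mul_assoc, rpow_sub_time_mul ht, rpow_sub_time_mul ht,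
    show γ - 1 + -γ + -γ = -1 - γ by ring]

/-- **Pressure gradient**: `∇(p(t))(x) = (T−t)^{γ−2} • (∇P)(y)`. [cite: ConstantinIgnatovaVicol2026Putative, §3.1 eq. (3.2) (scaling consequence of the ansatz)] -/
theorem gradient_selfSimilarCollapsePressure (ht : t < T) (P : EuclideanSpace ℝ (Fin 3) → ℝ)
    (x : EuclideanSpace ℝ (Fin 3)) :
    gradient (selfSimilarCollapsePressure γ T P t) x =
      (T - t) ^ (γ - 2) • gradient P ((T - t) ^ (-γ) • x) := by
  have h1 : selfSimilarCollapsePressure γ T P t =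
      fun y => (T - t) ^ (2 * (γ - 1)) • P ((T - t) ^ (-γ) • y) := by
    funext y; rw [selfSimilarCollapsePressure_apply, smul_eq_mul]
  rw [h1, gradient, fderiv_const_smul_comp_smul' P ((T - t) ^ (2 * (γ - 1))) ((T - t) ^ (-γ)) x,
    map_smul, rpow_sub_time_mul ht, show 2 * (γ - 1) + -γ = γ - 2 by ring]
  rfl

end Derivatives

/-! ### Vorticity and circulation on `ℝ³` -/

section Vorticity

variable {γ T t : ℝ}

/-- **Vorticity scale** (CIV (3.2): `ω(x,t) = (1−t)^{−1} Ω(y)`): `curl (u(t))(x) = (T−t)^{−1} •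
(curl U)(y)` — rate `(T−t)^{−1}` for every collapse exponent. [cite: ConstantinIgnatovaVicol2026Putative, §3.1 eq. (3.2)] -/
theorem curl_selfSimilarCollapse (ht : t < T) (U : EuclideanSpace ℝ (Fin 3) → EuclideanSpace ℝ (Fin 3))
    (x : EuclideanSpace ℝ (Fin 3)) :
    curl (selfSimilarCollapse γ T U t) x = (T - t) ^ (-1 : ℝ) • curl U ((T - t) ^ (-γ) • x) := by
  rw [show selfSimilarCollapse γ T U t = fun y => (T - t) ^ (γ - 1) • U ((T - t) ^ (-γ) • y)
    from rfl, curl_smul_comp_smul, rpow_sub_time_mul ht, show γ - 1 + -γ = (-1 : ℝ) by ring]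

/-- `‖ω(t, x)‖ = ‖(curl U)(y)‖ / (T − t)`. [cite: ConstantinIgnatovaVicol2026Putative, §3.1 eq. (3.2) (scaling consequence of the ansatz)] -/
theorem norm_curl_selfSimilarCollapse (ht : t < T) (U : EuclideanSpace ℝ (Fin 3) → EuclideanSpace ℝ (Fin 3))
    (x : EuclideanSpace ℝ (Fin 3)) :
    ‖curl (selfSimilarCollapse γ T U t) x‖ = ‖curl U ((T - t) ^ (-γ) • x)‖ / (T - t) := by
  rw [curl_selfSimilarCollapse ht, norm_smul, Real.rpow_neg_one,
    Real.norm_of_nonneg (inv_nonneg.mpr (sub_pos.mpr ht).le), inv_mul_eq_div]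

/-- **Circulation scale** (SELFSIM-NOGO (M5)(b): `Γ = r u^θ = (T−t)^{2c_l−1} Γ̃(y)`): the swirl
`Γ = swirl u = x₀u₁ − x₁u₀` of the ansatz is `(T−t)^{2γ−1}` times the swirl of the profile at `y`.
[cite: Hou2026, §3 p. 11 (total circulation conservation forces c_l → 1/2)] -/
theorem swirl_selfSimilarCollapse (ht : t < T) (U : EuclideanSpace ℝ (Fin 3) → EuclideanSpace ℝ (Fin 3))
    (x : EuclideanSpace ℝ (Fin 3)) :
    swirl (selfSimilarCollapse γ T U t) x = (T - t) ^ (2 * γ - 1) * swirl U ((T - t) ^ (-γ) • x) := by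
  have e : (T - t) ^ (2 * γ - 1) * (T - t) ^ (-γ) = (T - t) ^ (γ - 1) := by
    rw [rpow_sub_time_mul ht, show 2 * γ - 1 + -γ = γ - 1 by ring]
  simp only [swirl, selfSimilarCollapse_apply, PiLp.smul_apply, smul_eq_mul]
  linear_combination
    (-(x 0 * U ((T - t) ^ (-γ) • x) 1 - x 1 * U ((T - t) ^ (-γ) • x) 0)) * e

/-- **`γ < ½` with swirl violates the circulation bound** (SELFSIM-NOGO (M5)(b); Hou 2026 §3:
"Due to the total circulation conservation … we expect to have `c_l → 1/2`"): if `γ < ½` and the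
profile carries swirl at some point, `Γ_U(y₀) ≠ 0`, then for every `M` and all `t < T` close to
`T` some point has `|Γ(t, x)| > M` — incompatible with the maximum principle
`‖Γ(t)‖_∞ ≤ ‖Γ₀‖_∞` (`abs_swirl_le_of_classical`). [cite: Hou2026, §3 p. 11 (total circulation conservation forces c_l → 1/2)] -/
theorem swirl_unbounded_of_lt_half (hγ : γ < 1 / 2) {U : EuclideanSpace ℝ (Fin 3) → EuclideanSpace ℝ (Fin 3)}
    {y₀ : EuclideanSpace ℝ (Fin 3)} (hy₀ : swirl U y₀ ≠ 0)
    (M : ℝ) : ∀ᶠ t in 𝓝[<] T, ∃ x, M < |swirl (selfSimilarCollapse γ T U t) x| := by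
  -- `(T−t)^{2γ−1} → +∞` as `t ↑ T` since `2γ − 1 < 0`
  have h2 : Tendsto (fun t : ℝ => (T - t) ^ (2 * γ - 1)) (𝓝[<] T) atTop :=
    (tendsto_rpow_neg_nhdsGT_zero (by linarith)).comp (tendsto_sub_nhdsLT_nhdsGT T)
  have h3 : Tendsto (fun t : ℝ => (T - t) ^ (2 * γ - 1) * |swirl U y₀|) (𝓝[<] T) atTop :=
    h2.atTop_mul_const (abs_pos.mpr hy₀)
  filter_upwards [h3.eventually_gt_atTop M, self_mem_nhdsWithin] with t ht htT'
  have htT : t < T := Set.mem_Iio.mp htT'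
  refine ⟨(T - t) ^ γ • y₀, ?_⟩
  have hy : (T - t) ^ (-γ) • ((T - t) ^ γ • y₀) = y₀ := by
    rw [smul_smul, rpow_sub_time_mul htT, neg_add_cancel, Real.rpow_zero, one_smul]
  rw [swirl_selfSimilarCollapse htT, hy, abs_mul, abs_of_pos (rpow_sub_time_pos htT _)]
  exact ht

end Vorticity

/-! ### The time derivative and the Navier–Stokes momentum operator on the ansatz -/

section Momentum

variable {E : Type*} [NormedAddCommGroup E] [InnerProductSpace ℝ E] [FiniteDimensional ℝ E]
variable {γ T t ν : ℝ} {U : E → E} {P : E → ℝ}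

/-- `d/ds (T − s)^a = −a (T − s)^{a−1}` for `s < T`. [folklore] -/
private theorem hasDerivAt_rpow_sub_time (ht : t < T) (a : ℝ) :
    HasDerivAt (fun s : ℝ => (T - s) ^ a) (-a * (T - t) ^ (a - 1)) t := by
  have h1 : HasDerivAt (fun s : ℝ => T - s) (-1) t := by
    simpa using (hasDerivAt_id t).const_sub T
  have h2 := h1.rpow_const (p := a) (Or.inl (sub_pos.mpr ht).ne')
  convert h2 using 1
  ring

omit [FiniteDimensional ℝ E] in
/-- **The time line** (CIV (3.2) ⇒ (3.3)): for `U ∈ C¹` and `t < T`,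
`∂ₜ u(t, x) = (T−t)^{γ−2} • ((1−γ) U(y) + DU(y)(γ y))`, `y = (T−t)^{−γ} x`
(product rule with `d/dt (T−t)^{γ−1} = (1−γ)(T−t)^{γ−2}` and chain rule with
`d/dt (T−t)^{−γ} x = γ (T−t)^{−γ−1} x = γ (T−t)^{−1} y`). [cite: ConstantinIgnatovaVicol2026Putative, §3.1 eqs. (3.2)–(3.3)] -/
theorem hasDerivAt_selfSimilarCollapse_time (ht : t < T) (hU : ContDiff ℝ 1 U) (x : E) :
    HasDerivAt (fun s => selfSimilarCollapse γ T U s x)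
      ((T - t) ^ (γ - 2) • ((1 - γ) • U ((T - t) ^ (-γ) • x) +
        fderiv ℝ U ((T - t) ^ (-γ) • x) (γ • ((T - t) ^ (-γ) • x)))) t := by
  -- scalar factors
  have hk : HasDerivAt (fun s : ℝ => (T - s) ^ (γ - 1)) (-(γ - 1) * (T - t) ^ (γ - 1 - 1)) t :=
    hasDerivAt_rpow_sub_time ht (γ - 1)
  have hc : HasDerivAt (fun s : ℝ => (T - s) ^ (-γ)) (-(-γ) * (T - t) ^ (-γ - 1)) t :=
    hasDerivAt_rpow_sub_time ht (-γ)
  -- the inner map `s ↦ (T - s)^{-γ} • x` and the composition with `U`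
  have hin : HasDerivAt (fun s : ℝ => (T - s) ^ (-γ) • x) ((-(-γ) * (T - t) ^ (-γ - 1)) • x) t :=
    hc.smul_const x
  have hUd : HasFDerivAt U (fderiv ℝ U ((T - t) ^ (-γ) • x)) ((T - t) ^ (-γ) • x) :=
    (hU.differentiable one_ne_zero _).hasFDerivAt
  have hcomp : HasDerivAt (fun s : ℝ => U ((T - s) ^ (-γ) • x))
      (fderiv ℝ U ((T - t) ^ (-γ) • x) ((-(-γ) * (T - t) ^ (-γ - 1)) • x)) t :=
    hUd.comp_hasDerivAt t hin
  refine (hk.smul hcomp).congr_deriv ?_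
  -- bookkeeping of the exponents
  have e1 : -(γ - 1) * (T - t) ^ (γ - 1 - 1) = (T - t) ^ (γ - 2) * (1 - γ) := by
    rw [show γ - 1 - 1 = γ - 2 by ring]; ring
  have e2 : (T - t) ^ (γ - 1) * (-(-γ) * (T - t) ^ (-γ - 1)) =
      (T - t) ^ (γ - 2) * γ * (T - t) ^ (-γ) := by
    have h' : (T - t) ^ (γ - 1) * (T - t) ^ (-γ - 1) = (T - t) ^ (γ - 2) * (T - t) ^ (-γ) := by
      rw [rpow_sub_time_mul ht, rpow_sub_time_mul ht, show γ - 1 + (-γ - 1) = γ - 2 + -γ by ring]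
    linear_combination γ * h'
  rw [map_smul, smul_smul, e2, e1]
  simp only [smul_add, smul_smul, map_smul]
  module

omit [FiniteDimensional ℝ E] in
/-- The two-sided time derivative of the ansatz below the blow-up time:
`timeDeriv u t x = (T−t)^{γ−2} • ((1−γ)U(y) + DU(y)(γy))`. [cite: ConstantinIgnatovaVicol2026Putative, §3.1 eq. (3.2) (scaling consequence of the ansatz)] -/
theorem timeDeriv_selfSimilarCollapse (ht : t < T) (hU : ContDiff ℝ 1 U) (x : E) :
    timeDeriv (selfSimilarCollapse γ T U) t x =
      (T - t) ^ (γ - 2) • ((1 - γ) • U ((T - t) ^ (-γ) • x) +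
        fderiv ℝ U ((T - t) ^ (-γ) • x) (γ • ((T - t) ^ (-γ) • x))) :=
  (hasDerivAt_selfSimilarCollapse_time ht hU x).deriv

/-- The **effective viscosity** of the ansatz in similarity variables:
`ν_eff(t) = ν (T − t)^{1 − 2γ}` — the coefficient of `ΔU` when the Navier–Stokes momentum operator
applied to (SS_γ) is divided by the common factor `(T−t)^{γ−2}` (`ns_momentum_selfSimilarCollapse`).
Hou 2026 §1.1 / §3 write the same law as "`ν = ν₀(T−t)^{2c_l−1}`" for the PHYSICAL viscosity that
keeps the rescaled one constant. [cite: Hou2026, §1.1 and §3] -/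
def effectiveViscosity (ν γ T t : ℝ) : ℝ :=
  ν * (T - t) ^ (1 - 2 * γ)

/-- Unfolding `effectiveViscosity`. [cite: Hou2026, §1.1 and §3] -/
@[simp]
theorem effectiveViscosity_apply (ν γ T t : ℝ) :
    effectiveViscosity ν γ T t = ν * (T - t) ^ (1 - 2 * γ) := rfl

/-- At Leray's exponent `γ = ½` the effective viscosity is the physical one for all `t < T`. [cite: Hou2026, §1.1 (ν = ν₀(T−t)^{2c_l−1}) and §3 (νC_ψ/C_lz = ν₀)] -/
theorem effectiveViscosity_half (ν T t : ℝ) : effectiveViscosity ν (1 / 2) T t = ν := by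
  rw [effectiveViscosity_apply, show (1 : ℝ) - 2 * (1 / 2) = 0 by norm_num, Real.rpow_zero, mul_one]

/-- **The Navier–Stokes momentum operator on the ansatz** (the computation behind CIV (3.3),
Hou 2026 §3 and SELFSIM-NOGO (M7)–(M8)): for `U ∈ C¹`, any `P`, `t < T`, `ν : ℝ`,
with `u = selfSimilarCollapse γ T U`, `p = selfSimilarCollapsePressure γ T P`, `y = (T−t)^{−γ} x`,

`∂ₜu + (u·∇)u + ∇p − νΔu = (T−t)^{γ−2} • [ (1−γ)U(y) + DU(y)(γy + U(y)) + ∇P(y) − ν_eff(t) ΔU(y) ]`,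

`ν_eff(t) = ν(T−t)^{1−2γ}` (`effectiveViscosity`). Every inertial term scales like `(T−t)^{γ−2}`;
the viscous term alone carries the extra factor `(T−t)^{1−2γ}`. [cite: ConstantinIgnatovaVicol2026Putative, §3.1 eq. (3.2) (scaling consequence of the ansatz)] -/
theorem ns_momentum_selfSimilarCollapse {U : EuclideanSpace ℝ (Fin 3) → EuclideanSpace ℝ (Fin 3)}
    {P : EuclideanSpace ℝ (Fin 3) → ℝ} (ht : t < T) (hU : ContDiff ℝ 1 U) (ν : ℝ)
    (x : EuclideanSpace ℝ (Fin 3)) :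
    timeDeriv (selfSimilarCollapse γ T U) t x +
        convect (selfSimilarCollapse γ T U t) (selfSimilarCollapse γ T U t) x +
        gradient (selfSimilarCollapsePressure γ T P t) x -
        ν • (Δ (selfSimilarCollapse γ T U t)) x =
      (T - t) ^ (γ - 2) •
        ((1 - γ) • U ((T - t) ^ (-γ) • x) +
          fderiv ℝ U ((T - t) ^ (-γ) • x) (γ • ((T - t) ^ (-γ) • x) + U ((T - t) ^ (-γ) • x)) +
          gradient P ((T - t) ^ (-γ) • x) -
          effectiveViscosity ν γ T t • (Δ U) ((T - t) ^ (-γ) • x)) := by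
  rw [timeDeriv_selfSimilarCollapse ht hU, convect_selfSimilarCollapse ht,
    gradient_selfSimilarCollapsePressure ht, laplacian_selfSimilarCollapse ht, convect,
    effectiveViscosity_apply]
  have e : ν • (T - t) ^ (-1 - γ) • (Δ U) ((T - t) ^ (-γ) • x) =
      (T - t) ^ (γ - 2) • ((ν * (T - t) ^ (1 - 2 * γ)) • (Δ U) ((T - t) ^ (-γ) • x)) := by
    rw [smul_smul, smul_smul, mul_left_comm, rpow_sub_time_mul ht,
      show γ - 2 + (1 - 2 * γ) = -1 - γ by ring]
  rw [e, map_add]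
  module

/-- **An exact self-similar Euler profile gives an exact Euler solution below the blow-up time**
(CIV §3.1: (3.2) solves Euler iff `(U, P)` solves (3.3)): if `IsSelfSimilarEulerProfile γ 0 U P`
then `∂ₜu + (u·∇)u + ∇p = 0` pointwise for `t < T`. [cite: ConstantinIgnatovaVicol2026Putative, §3.1.1 eqs. (3.2)–(3.3)] -/
theorem IsSelfSimilarEulerProfile.euler_selfSimilarCollapse
    {U : EuclideanSpace ℝ (Fin 3) → EuclideanSpace ℝ (Fin 3)} {P : EuclideanSpace ℝ (Fin 3) → ℝ}
    (h : IsSelfSimilarEulerProfile γ 0 U P) (ht : t < T) (x : EuclideanSpace ℝ (Fin 3)) :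
    timeDeriv (selfSimilarCollapse γ T U) t x +
        convect (selfSimilarCollapse γ T U t) (selfSimilarCollapse γ T U t) x +
        gradient (selfSimilarCollapsePressure γ T P t) x = 0 := by
  have hmain := ns_momentum_selfSimilarCollapse (γ := γ) (T := T) (P := P) ht
    (h.contDiff_velocity.of_le one_le_two) 0 x
  have hprof := h.profile_eq ((T - t) ^ (-γ) • x)
  rw [sub_zero] at hprof
  rw [zero_smul, sub_zero, effectiveViscosity_apply, zero_mul, zero_smul, sub_zero, hprof,
    smul_zero] at hmain
  exact hmain

/-- **The Navier–Stokes defect of an Euler profile** (SELFSIM-NOGO (M7)/(M8); LIT-DOSSIER §8 "Euler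
window"): for an exact self-similar Euler profile and any `ν`, below `T` the ansatz satisfies
`∂ₜu + (u·∇)u + ∇p − νΔu = −(T−t)^{γ−2} ν_eff(t) • ΔU(y) = −ν (T−t)^{−1−γ} • ΔU(y)`:
viscosity enters similarity variables exactly through `ν_eff(t) = ν(T−t)^{1−2γ}`. [cite: ConstantinIgnatovaVicol2026Putative, §3.1 eq. (3.2) (scaling consequence of the ansatz)] -/
theorem IsSelfSimilarEulerProfile.ns_defect_selfSimilarCollapse
    {U : EuclideanSpace ℝ (Fin 3) → EuclideanSpace ℝ (Fin 3)} {P : EuclideanSpace ℝ (Fin 3) → ℝ}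
    (h : IsSelfSimilarEulerProfile γ 0 U P) (ht : t < T) (ν : ℝ) (x : EuclideanSpace ℝ (Fin 3)) :
    timeDeriv (selfSimilarCollapse γ T U) t x +
        convect (selfSimilarCollapse γ T U t) (selfSimilarCollapse γ T U t) x +
        gradient (selfSimilarCollapsePressure γ T P t) x -
        ν • (Δ (selfSimilarCollapse γ T U t)) x =
      -((T - t) ^ (γ - 2) • effectiveViscosity ν γ T t • (Δ U) ((T - t) ^ (-γ) • x)) := by
  have hmain := ns_momentum_selfSimilarCollapse (γ := γ) (T := T) (P := P) ht
    (h.contDiff_velocity.of_le one_le_two) ν x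
  have hprof := h.profile_eq ((T - t) ^ (-γ) • x)
  rw [sub_zero] at hprof
  rw [hprof, zero_sub, smul_neg] at hmain
  exact hmain

/-- The defect coefficient in closed form: `(T−t)^{γ−2} ν_eff(t) = ν (T−t)^{−1−γ}`. [cite: Hou2026, §1.1 (ν = ν₀(T−t)^{2c_l−1}) and §3 (νC_ψ/C_lz = ν₀)] -/
theorem rpow_mul_effectiveViscosity (ht : t < T) (ν : ℝ) :
    (T - t) ^ (γ - 2) * effectiveViscosity ν γ T t = ν * (T - t) ^ (-1 - γ) := by
  rw [effectiveViscosity_apply, mul_left_comm, rpow_sub_time_mul ht,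
    show γ - 2 + (1 - 2 * γ) = -1 - γ by ring]

end Momentum

/-! ### Asymptotics of the effective viscosity: the three regimes -/

section Regimes

variable {γ T ν : ℝ}

/-- **Regime `γ < ½` ("Euler window": viscosity asymptotically perturbative).** `ν_eff(t) → 0` as
`t ↑ T` (LIT-DOSSIER §8: `νΔu/∂ₜu ∼ ν(T−t)^{1−2β} → 0 iff β < ½`; SELFSIM-NOGO (M7)). [cite: Hou2026, §1.1 (ν = ν₀(T−t)^{2c_l−1}) and §3 (νC_ψ/C_lz = ν₀)] -/
theorem tendsto_effectiveViscosity_zero_of_lt_half (hγ : γ < 1 / 2) (ν : ℝ) :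
    Tendsto (effectiveViscosity ν γ T) (𝓝[<] T) (𝓝 0) := by
  have h2 : ContinuousAt (fun s : ℝ => s ^ (1 - 2 * γ)) 0 :=
    Real.continuousAt_rpow_const 0 _ (Or.inr (by linarith))
  have h3 := (h2.tendsto.comp ((tendsto_sub_nhdsLT_nhdsGT T).mono_right nhdsWithin_le_nhds))
  rw [Function.comp_def, Real.zero_rpow (by linarith : (0 : ℝ) < 1 - 2 * γ).ne'] at h3
  have h4 := h3.const_mul ν
  rw [mul_zero] at h4
  exact h4

/-- **Regime `γ > ½` (diffusion dominant).** For `ν > 0`, `ν_eff(t) → +∞` as `t ↑ T`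
(SELFSIM-NOGO (M8): "viscosity is not a perturbation of that profile but the dominant term"). [cite: Hou2026, §1.1 (ν = ν₀(T−t)^{2c_l−1}) and §3 (νC_ψ/C_lz = ν₀)] -/
theorem tendsto_effectiveViscosity_atTop_of_half_lt (hγ : 1 / 2 < γ) (hν : 0 < ν) :
    Tendsto (effectiveViscosity ν γ T) (𝓝[<] T) atTop := by
  have h2 : Tendsto (fun t : ℝ => (T - t) ^ (1 - 2 * γ)) (𝓝[<] T) atTop :=
    (tendsto_rpow_neg_nhdsGT_zero (by linarith)).comp (tendsto_sub_nhdsLT_nhdsGT T)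
  exact h2.const_mul_atTop hν

end Regimes

/-! ### Constant-exponent dynamic rescaling: the dictionary `γ = c_l/|c_ω|`, and Chen–Hou's numbers -/

section Dictionary

/-- **Constant exponents in the dynamic rescaling formulation** (Hou 2026 §3, p. 10–11 of the held
text; Chen–Hou CMP 2021 §4.1, tree `DynamicRescalingBlowup.lean`): with `C_ω(τ) = e^{c_ω τ}`
(`c_ω < 0`), `C_l(τ) = e^{−c_l τ}` and `t(τ) = ∫₀^τ C_ω`, one has `T − t(τ) = e^{c_ω τ}/|c_ω|`; this
lemma records the resulting identity `C_l = (|c_ω| (T − t))^{c_l/|c_ω|}` as pure real algebra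
(hypothesis: the relation between `T − t` and `τ`). Hence the physical length scale of a STEADY
dynamic-rescaling profile collapses like `(T−t)^γ` with `γ = c_l/|c_ω|` (Hou: `ĉ_l = c_l/(c_l−c_ψ)`
in his normalisation `C_u = (T−t)`). [cite: Hou2026, §3 (constant-exponent scaling formulas)] -/
theorem rescalingFactor_eq_rpow_of_constant_exponents {cl cω τ T t : ℝ} (hω : cω < 0)
    (hTt : T - t = Real.exp (cω * τ) / |cω|) :
    Real.exp (-cl * τ) = (|cω| * (T - t)) ^ (cl / |cω|) := by
  have hne : cω ≠ 0 := hω.ne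
  have hne' : |cω| ≠ 0 := abs_ne_zero.mpr hne
  have h1 : |cω| * (T - t) = Real.exp (cω * τ) := by
    rw [hTt]; field_simp
  rw [h1, ← Real.exp_mul, abs_of_neg hω]
  congr 1
  field_simp

/-- **Chen–Hou's printed rescaling exponent `c̄_l`** of their approximate self-similar profile
(2D Boussinesq / 3D Euler near the wall): "`c̄_l ≈ 3.00649898`" (Part I, §3 "Exponents"). A printed
numerical parameter of a computed profile (data), recorded for the exponent arithmetic below.
[cite: arXiv221007191, §3 (Properties of the approximate steady state: Exponents)] -/
def chenHou_cl : ℝ := 3.00649898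

/-- **Chen–Hou's printed rescaling exponent `c̄_ω`**: "`c̄_ω ≈ −1.02942516`"; "the ratio
`c̄_l/c̄_ω ≈ −2.9205600` is very close to the one reported by Hou–Luo" (Part I, §3 "Exponents").
Data, as `chenHou_cl`. [cite: arXiv221007191, §3 (Properties of the approximate steady state: Exponents)] -/
def chenHou_cω : ℝ := -1.02942516

/-- The **collapse exponent of the Chen–Hou profile** in the (SS_γ) convention:
`γ_CH = c̄_l/|c̄_ω|` (`≈ 2.92`; dictionary `rescalingFactor_eq_rpow_of_constant_exponents`). [cite: arXiv221007191, §3 (ratio c̄_l/c̄_ω ≈ −2.9205600)] -/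
def chenHou_collapseExponent : ℝ := chenHou_cl / |chenHou_cω|

/-- `γ_CH > 2.9` (in particular `> ½`): kernel arithmetic on the printed numbers. [cite: arXiv221007191, §3 (Exponents: c̄_l ≈ 3.00649898, c̄_ω ≈ −1.02942516)] -/
theorem chenHou_collapseExponent_gt : (2.9 : ℝ) < chenHou_collapseExponent := by
  rw [chenHou_collapseExponent, chenHou_cl, chenHou_cω,
    abs_of_neg (by norm_num : (-1.02942516 : ℝ) < 0)]
  norm_num

/-- `γ_CH > ½`. [cite: arXiv221007191, §3 (Exponents: c̄_l ≈ 3.00649898, c̄_ω ≈ −1.02942516)] -/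
theorem half_lt_chenHou_collapseExponent : (1 / 2 : ℝ) < chenHou_collapseExponent :=
  lt_trans (by norm_num) chenHou_collapseExponent_gt

/-- **SELFSIM-NOGO (M8) as a limit**: along a collapse with the Chen–Hou exponent `γ_CH ≈ 2.92`,
the effective viscosity `ν(T−t)^{1−2γ_CH}` of any `ν > 0` tends to `+∞` as `t ↑ T` — adding
viscosity to that profile is not a perturbation (`1 − 2γ_CH ≈ −4.84`). WHAT THIS IS NOT: a
statement about the exponents of a computed approximate profile, not about Navier–Stokes. [cite: arXiv221007191, §3 (Exponents: c̄_l ≈ 3.00649898, c̄_ω ≈ −1.02942516)] -/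
theorem tendsto_effectiveViscosity_chenHou_atTop {ν T : ℝ} (hν : 0 < ν) :
    Tendsto (effectiveViscosity ν chenHou_collapseExponent T) (𝓝[<] T) atTop :=
  tendsto_effectiveViscosity_atTop_of_half_lt half_lt_chenHou_collapseExponent hν

/-- **Hou's reported exponent vs constant viscosity** (Hou 2026 §1.1: `Z(t) = (T−t)^{c_l}`,
`c_l = 0.5233`; "`ν = ν₀‖u₁‖_∞Z(t)² = ν₀(T−t)^{2c_l−1}`"): the reported collapse exponent exceeds `½`,
so with a CONSTANT viscosity the effective viscosity `ν(T−t)^{1−2c_l}` of the rescaled equations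
tends to `+∞` — the counterpart of `tendsto_hou2026_viscosity_zero` (`HouTwoScaleRescaling.lean`:
the computation keeps the rescaled viscosity fixed by letting the physical one tend to `0`).
[cite: Hou2026, §1.1 (c_l = 0.5233, ν = ν₀(T−t)^{2c_l−1})] -/
theorem tendsto_effectiveViscosity_hou2026_atTop {ν T : ℝ} (hν : 0 < ν) :
    Tendsto (effectiveViscosity ν hou2026_collapseExponent T) (𝓝[<] T) atTop :=
  tendsto_effectiveViscosity_atTop_of_half_lt half_lt_hou2026_collapseExponent hν

/-- **The WLGSB ansatz in this file's convention**: for `u = (1−t)^λ U(x/(1−t)^{1+λ})` the collapse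
exponent is `γ = 1 + λ` (`collapseExponent_wlgsb`) and the effective viscosity is
`ν(T−t)^{1−2(1+λ)} = ν(T−t)^{dissipationExponent 2 λ}` (`SelfSimilarBoussinesqProfile.lean`).
[cite: WangLaiGomezSerranoBuckmaster2023, §1.1 eq. (1.2)] -/
theorem effectiveViscosity_wlgsb (ν lam T t : ℝ) :
    effectiveViscosity ν (collapseExponent_wlgsb lam) T t =
      ν * (T - t) ^ dissipationExponent 2 lam := by
  rw [effectiveViscosity, collapseExponent_wlgsb, dissipationExponent]

/-- **The printed Boussinesq/Euler hierarchy vs constant viscosity** (Wang et al. 2025: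
`λ_n ∼ 1/(1.4187n + 1.0863) + 1`, "It is expected that higher-order instability makes it more feasible
to treat viscosity as a perturbative error"): every `γ_n = 1 + λ_n` exceeds `½` (indeed `2`), so along
the printed law a constant viscosity is never perturbative — the effective viscosity tends to `+∞` at
the collapse time.  An arithmetic consequence of the printed numbers, not a claim of the source.
[cite: WangEtAl2025, main text (empirical rule λ_n ∼ 1/(1.4187n + 1.0863) + 1, p. 4)] -/
theorem tendsto_effectiveViscosity_wlgsb_atTop {ν T : ℝ} (hν : 0 < ν) (n : ℕ) :
    Tendsto (effectiveViscosity ν (collapseExponent_wlgsb (wangEtAl2025_boussinesqLambda n)) T)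
      (𝓝[<] T) atTop := by
  refine tendsto_effectiveViscosity_atTop_of_half_lt ?_ hν
  have h := one_lt_boussinesqLambda n
  rw [collapseExponent_wlgsb]
  linarith

end Dictionary

end Literature.Analysis.FluidPDE
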